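import Summits.AnomalousDissipation.AnomalousDissipation.Theorems.SawtoothPulseCascadeK1LocalisedCascadeOscJunkBounds

/-!
# K1loc — helper: RATIONAL CERTIFICATES FOR THE JUNK OF THE THIN STEPS (numeric layer, typed tools)

Helper file of the prover lane on the crux `K1LocalisedCascade` (stmt-AnomalousDissipation-19491), route `SawtoothPulseCascade`
(S-B/S-C assembly seat; the LEDGER ASSEMBLY, thin tail / junction numerics; companion of `…OscJunkNumeric`).  The thin steps
(`…ThinStripStepsOsc`, `…ThinRatioStepsOsc`, instantiated in `…PhaseThin`) leave junk amplitudes of two shapes,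
  strip: `√(3r²((4/3)(AπG ηΛ/N·2^{M_b})² + M_b(2N/(πD))² + M_b·4NA/(πD) + M_b(8NA²√(4Z/(πD)) + 8A²Z/π)))`,
  ratio: `√(3r²((4/3)(AπG ηΛ/N·2^{M_b})² + 9(2N/(πD))² + 9·4NA/(πD) + M_b(8NA²√(4Z/(πD)) + 8A²Z/π)))`,
`Z = max(1,√(2log(1/η)))·δ_j`, where `A`, `D` are closed-form real constants of the geometry (themselves bounded by rationals at each
instance).  As in `…OscJunkNumeric`, both are bounded by a rational `w` from certificates decided by `norm_num`:
`1/η ≤ 2^m`, `M₀ ≥ max(1, √(1.3862943616·m))`, `δ₀ ≤ δ*`, `A ≤ A₁`, `0 < D₁ ≤ D`, `s² ≥ 4M₀δ*/(2^j·3.141592·D₁)`,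
`(A₁·3.1416·G·ηΛ/N·2^{M_b})² ≤ e₀` and `w² ≥` the rational junk:
* `sqrt_stripThinJunk_le_of_cert`, `sqrt_ratioThinJunk_le_of_cert` (each also returns `Z ≤ M₀δ*/2^j` for the side condition `< π/2`).
Pure real arithmetic; no definitions; no statement about the crux. [cite: Grafakos2014, Prop. 3.2.7 (3)] [problem: turb]
-/

-- `Summit.<Summit>.<Problem>`: single-conjunct summit, the duplicate namespace segment is deliberate.
set_option linter.dupNamespace false

noncomputable section

namespace Summit.AnomalousDissipation.AnomalousDissipation.Theorems.SawtoothPulseCascade.K1Window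

open Real
open Literature.Analysis.FluidPDE.SawtoothCascade Literature.Analysis.FluidPDE.SawtoothCascade.CascadeParams

/-- **The zone depth of a plain rounding target**: `0 < η`, `1/η ≤ 2^m`, `1 ≤ M₀`, `1.3862943616·m ≤ M₀²`, `d = 2`, `0 ≤ δ₀ ≤ δ*` give
`0 ≤ max(1,√(2log(1/η)))·δ_j ≤ M₀δ*/2^j`. [folklore] -/
theorem zoneDepth_delta_le (P : CascadeParams) (hd : P.d = 2) {δs : ℝ} (hδ₀ : 0 ≤ P.δ₀) (hδ₀' : P.δ₀ ≤ δs) {η M₀ : ℝ} {m : ℕ}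
    (hη : 0 < η) (hηm : 1 / η ≤ 2 ^ m) (hM₀ : 1 ≤ M₀) (hM : 1.3862943616 * m ≤ M₀ ^ 2) (j : ℕ) :
    0 ≤ max 1 (Real.sqrt (2 * Real.log (1 / η))) * P.δ j ∧ max 1 (Real.sqrt (2 * Real.log (1 / η))) * P.δ j ≤ M₀ * (δs / 2 ^ j) := by
  obtain ⟨hδ0, hδle⟩ := P.delta_le_of_le hd hδ₀ hδ₀' j
  have hM1 := zoneDepth_le hη hηm hM₀ hM
  exact ⟨mul_nonneg (le_max_left _ _ |>.trans' zero_le_one) hδ0,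
    (mul_le_mul_of_nonneg_right hM1 hδ0).trans (mul_le_mul_of_nonneg_left hδle (by linarith))⟩

/-- **Generic comparison of the thin junk shape against rationals**: for `0 ≤ A ≤ A₁`, `0 < D₁ ≤ D`, `0 ≤ Z ≤ Z₀`, `0 ≤ s` with
`4Z₀/(3.141592D₁) ≤ s²`, `0 ≤ N, Λ, c₁, c₂, c₃`, `0 < η`, `G ≥ 0` and `(A₁·3.1416·G·ηΛ/N·2^{M_b})² ≤ e₀` (`N > 0`):
`3r²((4/3)(AπGηΛ/N·2^{M_b})² + c₁(2N/(πD))² + c₂·4NA/(πD) + c₃(8NA²√(4Z/(πD)) + 8A²Z/π))`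
`≤ 3r²((4/3)e₀ + c₁(2N/(3.141592D₁))² + c₂·4NA₁/(3.141592D₁) + c₃(8NA₁²s + 8A₁²Z₀/3.141592))`. [folklore] -/
theorem thinJunk_le {r A A₁ D D₁ Z Z₀ s N Λ η G e₀ c₁ c₂ c₃ : ℝ} {Mb : ℕ} (hA0 : 0 ≤ A) (hA : A ≤ A₁) (hD₁ : 0 < D₁) (hD : D₁ ≤ D)
    (hZ0 : 0 ≤ Z) (hZ : Z ≤ Z₀) (hs0 : 0 ≤ s) (hs : 4 * Z₀ / (3.141592 * D₁) ≤ s ^ 2) (hN : 0 < N) (hΛ : 0 ≤ Λ) (hη : 0 < η)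
    (hG : 0 ≤ G) (hc₁ : 0 ≤ c₁) (hc₂ : 0 ≤ c₂) (hc₃ : 0 ≤ c₃) (he : (A₁ * 3.1416 * G * η * Λ / N * 2 ^ Mb) ^ 2 ≤ e₀) :
    3 * r ^ 2 * (4 / 3 * (A * π * G * η * Λ / N * 2 ^ Mb) ^ 2 + c₁ * (2 * N / (π * D)) ^ 2 + c₂ * (4 * N * A / (π * D)) +
        c₃ * (8 * N * A ^ 2 * Real.sqrt (4 * Z / (π * D)) + 8 * A ^ 2 * Z / π)) ≤
      3 * r ^ 2 * (4 / 3 * e₀ + c₁ * (2 * N / (3.141592 * D₁)) ^ 2 + c₂ * (4 * N * A₁ / (3.141592 * D₁)) +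
        c₃ * (8 * N * A₁ ^ 2 * s + 8 * A₁ ^ 2 * Z₀ / 3.141592)) := by
  have hπlo := Real.pi_gt_d6
  have hπhi := Real.pi_lt_d4
  have hπ0 : (0 : ℝ) < 3.141592 := by norm_num
  have hDpos : 0 < D := lt_of_lt_of_le hD₁ hD
  have hπD : 3.141592 * D₁ ≤ π * D := mul_le_mul hπlo.le hD hD₁.le Real.pi_pos.le
  have hπD0 : 0 < 3.141592 * D₁ := mul_pos hπ0 hD₁
  have hA₁ : 0 ≤ A₁ := hA0.trans hA
  -- the `η` term: `A π ≤ A₁ · 3.1416`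
  have t1 : (A * π * G * η * Λ / N * 2 ^ Mb) ^ 2 ≤ e₀ := by
    refine le_trans (pow_le_pow_left₀ (by positivity) ?_ 2) he
    have h1 : A * π ≤ A₁ * 3.1416 := mul_le_mul hA hπhi.le Real.pi_pos.le hA₁
    have h2 : 0 ≤ G * η * Λ / N * 2 ^ Mb := by positivity
    calc A * π * G * η * Λ / N * 2 ^ Mb = (A * π) * (G * η * Λ / N * 2 ^ Mb) := by ring
      _ ≤ (A₁ * 3.1416) * (G * η * Λ / N * 2 ^ Mb) := mul_le_mul_of_nonneg_right h1 h2
      _ = A₁ * 3.1416 * G * η * Λ / N * 2 ^ Mb := by ring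
  have t2 : 2 * N / (π * D) ≤ 2 * N / (3.141592 * D₁) := div_le_div_of_nonneg_left (by positivity) hπD0 hπD
  have t2' : (2 * N / (π * D)) ^ 2 ≤ (2 * N / (3.141592 * D₁)) ^ 2 := pow_le_pow_left₀ (by positivity) t2 2
  have t3 : 4 * N * A / (π * D) ≤ 4 * N * A₁ / (3.141592 * D₁) :=
    (div_le_div_of_nonneg_left (by positivity) hπD0 hπD).trans (div_le_div_of_nonneg_right (by nlinarith) hπD0.le)
  have t4a : 4 * Z / (π * D) ≤ 4 * Z₀ / (3.141592 * D₁) :=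
    (div_le_div_of_nonneg_left (by positivity) hπD0 hπD).trans (div_le_div_of_nonneg_right (by linarith) hπD0.le)
  have t4 : Real.sqrt (4 * Z / (π * D)) ≤ s := Real.sqrt_le_iff.mpr ⟨hs0, t4a.trans hs⟩
  have hAA : A ^ 2 ≤ A₁ ^ 2 := pow_le_pow_left₀ hA0 hA 2
  have t5 : 8 * N * A ^ 2 * Real.sqrt (4 * Z / (π * D)) ≤ 8 * N * A₁ ^ 2 * s :=
    mul_le_mul (by nlinarith) t4 (Real.sqrt_nonneg _) (by positivity)
  have t6 : 8 * A ^ 2 * Z / π ≤ 8 * A₁ ^ 2 * Z₀ / 3.141592 :=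
    (div_le_div_of_nonneg_left (by positivity) hπ0 hπlo.le).trans
      (div_le_div_of_nonneg_right (by nlinarith [mul_le_mul hAA hZ hZ0 (sq_nonneg A₁)]) hπ0.le)
  have hr : 0 ≤ 3 * r ^ 2 := by positivity
  refine mul_le_mul_of_nonneg_left ?_ hr
  have s1 := mul_le_mul_of_nonneg_left t2' hc₁
  have s2 := mul_le_mul_of_nonneg_left t3 hc₂
  have s3 := mul_le_mul_of_nonneg_left (add_le_add t5 t6) hc₃
  linarith

/-- **Certified thin junk amplitude** (both shapes: `c₁ = c₂ = M_b` for the strip steps, `c₁ = c₂ = 9` for the ratio steps; `c₃ = M_b`):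
with the rounding certificate (`1/η ≤ 2^m`, `M₀`), `0 ≤ δ₀ ≤ δ*`, `d = 2`, the geometry certificates `0 ≤ A ≤ A₁`, `0 < D₁ ≤ D` and the
rational inequalities `4(M₀δ*/2^j)/(3.141592D₁) ≤ s²`, `(A₁·3.1416·G·ηΛ/N·2^{M_b})² ≤ e₀`, rational junk `≤ w²`:
`√J ≤ w` and `Z ≤ M₀δ*/2^j`. [folklore] -/
theorem sqrt_thinJunk_le_of_cert (P : CascadeParams) (hd : P.d = 2) {δs : ℝ} (hδ₀ : 0 ≤ P.δ₀) (hδ₀' : P.δ₀ ≤ δs)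
    {r A A₁ D D₁ s N Λ η G e₀ c₁ c₂ c₃ w M₀ : ℝ} {Mb m : ℕ} (j : ℕ) (hA0 : 0 ≤ A) (hA : A ≤ A₁) (hD₁ : 0 < D₁) (hD : D₁ ≤ D)
    (hN : 0 < N) (hΛ : 0 ≤ Λ) (hη : 0 < η) (hG : 0 ≤ G) (hc₁ : 0 ≤ c₁) (hc₂ : 0 ≤ c₂) (hc₃ : 0 ≤ c₃)
    (hηm : 1 / η ≤ 2 ^ m) (hM₀ : 1 ≤ M₀) (hM : 1.3862943616 * m ≤ M₀ ^ 2)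
    (hs0 : 0 ≤ s) (hs : 4 * (M₀ * (δs / 2 ^ j)) / (3.141592 * D₁) ≤ s ^ 2)
    (he : (A₁ * 3.1416 * G * η * Λ / N * 2 ^ Mb) ^ 2 ≤ e₀) (hw : 0 ≤ w)
    (hJ : 3 * r ^ 2 * (4 / 3 * e₀ + c₁ * (2 * N / (3.141592 * D₁)) ^ 2 + c₂ * (4 * N * A₁ / (3.141592 * D₁)) +
        c₃ * (8 * N * A₁ ^ 2 * s + 8 * A₁ ^ 2 * (M₀ * (δs / 2 ^ j)) / 3.141592)) ≤ w ^ 2) :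
    Real.sqrt (3 * r ^ 2 * (4 / 3 * (A * π * G * η * Λ / N * 2 ^ Mb) ^ 2 + c₁ * (2 * N / (π * D)) ^ 2 + c₂ * (4 * N * A / (π * D)) +
        c₃ * (8 * N * A ^ 2 * Real.sqrt (4 * (max 1 (Real.sqrt (2 * Real.log (1 / η))) * P.δ j) / (π * D)) +
          8 * A ^ 2 * (max 1 (Real.sqrt (2 * Real.log (1 / η))) * P.δ j) / π))) ≤ w ∧
      max 1 (Real.sqrt (2 * Real.log (1 / η))) * P.δ j ≤ M₀ * (δs / 2 ^ j) := by
  obtain ⟨hZ0, hZ⟩ := zoneDepth_delta_le P hd hδ₀ hδ₀' hη hηm hM₀ hM j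
  refine ⟨Real.sqrt_le_iff.mpr ⟨hw, ?_⟩, hZ⟩
  exact (thinJunk_le (r := r) hA0 hA hD₁ hD hZ0 hZ hs0 hs hN hΛ hη hG hc₁ hc₂ hc₃ he).trans hJ

end Summit.AnomalousDissipation.AnomalousDissipation.Theorems.SawtoothPulseCascade.K1Window
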